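import Literature.NumberTheory.GaloisRepresentations.GaloisRep
import HarnessLib

/-!
# Locally potentially equivalent Galois representations (Patankar–Rajan 2010)

Named fact (D-0014; unproved here, used as a hypothesis `(h : exists_conj_restrictField_of_charpoly_pow_eq)`): the special case of
[Patankar–Rajan, *Locally potentially equivalent Galois representations*, J. Ramanujan Math. Soc. 27 (2012) 77–90 = arXiv:1010.5393, Thm. 2 p. 4 and Cor. 1 of the arXiv version] in which the
exceptional set of places is finite and the exponent is fixed.  Let `ρ₁, ρ₂ : Γ_K → GL_n(ℚ̄_ℓ)` be continuous semisimple representations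
of the absolute Galois group of a number field `K` and `m ≥ 1`.  If for all but finitely many finite places `v` both are unramified at
`v` and the characteristic polynomials of `ρ₁(σ^m)` and `ρ₂(σ^m)` agree for every arithmetic Frobenius `σ` at every prime above `v`
(when the `ρᵢ(σ)` are semisimple this IS «local potential equivalence at `v`» in the sense of op. cit. Def. 1–2; in general it is exactly the
input the printed proof consumes — see the review note), then `ρ₁` and `ρ₂` are POTENTIALLY EQUIVALENT: there is a finite Galois extension `M/K` over which they become conjugate.

As printed, Thm. 2 asks local potential equivalence on a set `T` of places of upper density `> 1 − 1/c` (here `T` is cofinite, density 1)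
for `ℓ`-adic representations with coefficients in a finite extension `F/ℚ_ℓ` unramified outside a finite set; the proof (§2.2, pp. 5–6)
uses only the equalities `Tr ρ₁(σ_v)^m = Tr ρ₂(σ_v)^m` on `T` — the subvariety `X_m = {Tr g₁^m = Tr g₂^m}` of the algebraic monodromy
group of `ρ₁ × ρ₂` contains a density-`> 1 − 1/c` set of Frobenius classes, hence (Rajan's algebraic Chebotarev theorem,
[Rajan 1998, Thm. 3]) the identity component, on which `ρ₁ ≅ ρ₂` by semisimplicity — which the characteristic-polynomial hypothesis below
supplies; `ℚ̄_ℓ`-coefficients reduce to a finite `E/ℚ_ℓ` because a compact subgroup of `GL_n(ℚ̄_ℓ)` lies in some `GL_n(E)` [folklore], and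
equivalence on an open subgroup `Γ_{K'}` gives conjugacy on `Γ_M` for the Galois closure `M` of `K'`.  Review note (honest delta to print): `T` cofinite / one exponent / Galois closure are faithful specialisations; the HYPOTHESIS is typed as
«equal characteristic polynomials of `m`-th Frobenius powers» rather than the printed «locally potentially equivalent at `v`» — the two agree when
Frobenius images are semisimple, and in general the typed form is precisely what the proof of Thm. 2 uses (op. cit. Remark 5, p. 6: for
`ud(T) = 1`, Lemma 1 + algebraic Chebotarev give `G ⊆ X_m`, `x ↦ x^m` maps `G°` onto itself so `G° ⊆ X_1`, and Chebotarev + semisimplicity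
finish); a reviewer who wants the literal print hypothesis adds «`ρᵢ(σ)` semisimple for a.e. `v`» to the binder list — the node's use
(`par_core`) would then need Frobenius-semisimplicity of the compared representations, which is NOT available in general, so the typed
(proof-level) form is the one the Langlands routes need.  The sequel [Patankar–Rajan,
*On the structure of locally potentially equivalent Galois representations*, J. Number Theory 221 (2021) 190–210 = arXiv:1901.03820, Thms. 1–3] treats
sets `T` of positive density under connectedness of the monodromy group of `ρ₁` and gives `ρ₂ ≅ ρ₁ ⊗ χ` when `ρ₁` is absolutely irreducible
(Thm. 3); it is not needed for the cofinite case stated here.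
-/

namespace Literature.NumberTheory.GaloisRepresentations

open IsDedekindDomain Filter

/-- **Patankar–Rajan 2012 (arXiv 2010), Thm. 2 / Cor. 1 (special case: cofinite set of places, fixed exponent `m`).**  Two continuous semisimple
`ρ₁ ρ₂ : Γ_K → GL_n(ℚ̄_ℓ)` whose `m`-th Frobenius powers have equal characteristic polynomials at almost every place are conjugate after
restriction to `Γ_M` for some finite Galois `M/K`.  Named fact (D-0014), used as a hypothesis.
[cite: PatankarRajan2012, Thm. 2 (arXiv:1010.5393 p. 4; with Def. 1 and Cor. 1; proof §2.2 pp. 5–6 via X_m and Rajan's algebraic Chebotarev theorem)] -/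
def exists_conj_restrictField_of_charpoly_pow_eq : Prop :=
  ∀ (K : Type) [Field K] [NumberField K] (n ℓ : ℕ) [Fact ℓ.Prime] (ρ₁ ρ₂ : Literature.NumberTheory.GaloisRepresentations.FramedGaloisRep K (PadicAlgCl ℓ) n), ρ₁.toGaloisRep.IsSemisimple → ρ₂.toGaloisRep.IsSemisimple → ∀ (m : ℕ), 0 < m → (∀ᶠ v : IsDedekindDomain.HeightOneSpectrum (NumberField.RingOfIntegers K) in cofinite, ρ₁.IsUnramifiedAt v ∧ ρ₂.IsUnramifiedAt v ∧ ∀ 𝔓 ∈ v.primesAbove, ∀ σ : Field.absoluteGaloisGroup K, IsArithFrobAt (NumberField.RingOfIntegers K) σ 𝔓 → Literature.NumberTheory.GaloisRepresentations.FramedRep.charpoly ρ₁ (σ ^ m) = Literature.NumberTheory.GaloisRepresentations.FramedRep.charpoly ρ₂ (σ ^ m)) → ∃ (M : Type) (_ : Field M) (_ : NumberField M) (_ : Algebra K M), IsGalois K M ∧ ∃ P : GL (Fin n) (PadicAlgCl ℓ), Literature.NumberTheory.GaloisRepresentations.FramedRep.conj P (ρ₁.restrictField M) = ρ₂.restrictField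 M

end Literature.NumberTheory.GaloisRepresentations
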